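import Literature.NumberTheory.EllipticCurves.DivisionTowerH1VanishingOfHomothetyProofs
import HarnessLib

/-!
# `(a − 1) · ker (H¹(K, E[n]) → H¹(L, E[n])) = 0` from ONE homothety `a` on `E[n]`;
# at `p = 2`: `2 · H¹(K(E[2^k])/K, E[2^k]) = 0` (Sah; Lawson–Wuthrich 2016 at the even prime)

`Proofs`-style file (THEOREMS ONLY: no definition, no named fact, no instance), topic
`NumberTheory/EllipticCurves`; continues `DivisionTowerH1VanishingOfHomothetyProofs.lean`
(`LawsonWuthrich2016.subgroupResKer_geomTorsion_eq_bot_of_homothety`: a homothety `a` with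
`p ∤ a − 1` KILLS the restriction kernel), which is empty at `p = 2` for the homotheties `±1, 3, …`
available there (`a − 1` is even).  The replacement at the even prime is the ANNIHILATOR form of
Sah's lemma: the restriction kernel is killed by `a − 1`, hence by `2`.

## What is proved

* `Rubin1987.smul_sub_apply_eq_of_vanishingOn` — Sah's identity modulo an open normal `N`: for a
  crossed homomorphism `f : G → M` vanishing on `N` and `g₀` central modulo `N`,
  `g₀ • f g − f g = g • f g₀ − f g₀`;  `Rubin1987.sub_one_zsmul_inflClass_eq_zero` /
  `Rubin1987.sub_one_zsmul_eq_zero_of_mem_subgroupResKer` — if `g₀` acts on `M` as the scalar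
  `c ∈ ℤ`, then `(c − 1) · κ = 0` for every `κ ∈ ker (H¹(G, M) → H¹(N, M))` (the class `(c − 1)f` is
  the coboundary of `f g₀`);  `Rubin1987.subgroupResKer_antitone` — the kernel grows as the subgroup
  shrinks.
* `LawsonWuthrich2016.sub_one_zsmul_eq_zero_of_mem_subgroupResKer_of_homothety` — for an elliptic
  curve `E/K` over ANY field, `n ≠ 0`, ONE `σ ∈ Γ_K` acting on `E[n] = E(K̄)[n]` as a homothety
  `a ∈ ℤ`, and every open normal `N ⊴ Γ_K` containing `Γ_{K(E[n])}` (i.e. `N = Gal(K̄/L)`,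
  `L ⊆ K(E[n])` Galois over `K`): `(a − 1) · κ = 0` for all `κ ∈ ker (H¹(Γ_K, E[n]) → H¹(N, E[n]))`
  — `(a − 1) · H¹(Gal(L/K), E(L)[n]) = 0`.
* `…two_zsmul_eq_zero_of_mem_subgroupResKer_of_smul_eq_neg` — `a = −1`: `2 · H¹(L/K, E(L)[n]) = 0`;
  `…_of_hasSurjectiveModNGaloisRep` — in particular whenever `ρ̄_{E,n}` is SURJECTIVE (`−1` is in the
  image), e.g. `n = 2^k` on the habitat of the `p = 2` Kolyvagin routes;
  `…two_zsmul_eq_zero_of_forall_h1Eval_eq_zero…` — the same in the pairing currency of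
  `HeegnerPointsKolyvaginPairing`: if `[x, ρ] = 0` for all `ρ ∈ Γ_{K(E[n])}` then `2x = 0`.

At `p = 2` the annihilator `2` is sharp: for the full image `GL₂(ℤ/2^k)`, `k ≥ 2`, the group
`H¹(GL₂(ℤ/2^k), (ℤ/2^k)²)` is NON-ZERO (of order `2`; cf. Lawson–Wuthrich 2016 §7.1 for the level-`4`
numerics) — the ORDER bound `≤ 2` is not proved in this file.  Consumers: the
`p = 2` Kolyvagin-system lines (route `GenusKolyvaginAtTwo`, items 22136/22137: every visibility /
`torsionFixing`-injectivity hypothesis at `2` holds up to ONE factor `2`).  «beyond-print theorem»: no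
(Sah 1968 Prop. 2.7(b); Lawson–Wuthrich 2016 Lemma 3 mechanism).  BSD is NOT proved by this file.

References: C.-H. Sah, J. Algebra 10 (1968), Prop. 2.7 (b) [Sah1968]; T. Lawson, C. Wuthrich,
*Vanishing of some Galois cohomology groups for elliptic curves* (2016), Lemma 3 and §7.1
[LawsonWuthrich2016]; K. Rubin, LNM 1716 (1999), Lemma 6.2 (i) [Rubin1999]; J.-P. Serre, *Galois
Cohomology*, I.§5.8 [SerreGaloisCohomology1997].
-/

set_option autoImplicit false

noncomputable section

open scoped Classical

open WeierstrassCurve Field Literature.NumberTheory.GaloisRepresentations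

universe u

namespace Literature.NumberTheory.EllipticCurves

/-! ### §1 Sah's identity modulo `N` and the annihilator `c − 1` (abstract) -/

namespace Rubin1987

section SahModN

variable {G : Type u} [Group G] {M : Type u} [AddCommGroup M] [DistribMulAction G M]

/-- **Sah's identity modulo `N`.** For `N ⊴ G`, a crossed homomorphism `f : G → M` vanishing on `N`
and `g₀ ∈ G` central modulo `N` (`g₀ g ∈ g g₀ N`): `g₀ • f g − f g = g • f g₀ − f g₀` for every `g`
(expand `f (g₀ g) = f (g g₀ n) = f (g g₀)` both ways). [cite: Sah1968, Prop. 2.7 (b)]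
[cite: Rubin1999, Lemma 6.2 (i) (proof)] -/
theorem smul_sub_apply_eq_of_vanishingOn {N : Subgroup G} [N.Normal]
    (f : cocyclesVanishingOn M N) {g₀ : G} (hcomm : ∀ g : G, ∃ n ∈ N, g₀ * g = g * g₀ * n) (g : G) :
    g₀ • f.1 g - f.1 g = g • f.1 g₀ - f.1 g₀ := by
  obtain ⟨n, hn, hc⟩ := hcomm g
  have h1 : f.1 (g₀ * g) = f.1 g₀ + g₀ • f.1 g := cocyclesVanishingOn.cocycle f g₀ g
  have h2 : f.1 (g * g₀ * n) = f.1 g + g • f.1 g₀ := by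
    rw [cocyclesVanishingOn.apply_mul_of_mem f _ hn, cocyclesVanishingOn.cocycle f g g₀]
  rw [hc] at h1
  have h3 : f.1 g₀ + g₀ • f.1 g = f.1 g + g • f.1 g₀ := h1.symm.trans h2
  rw [sub_eq_sub_iff_add_eq_add, add_comm (g₀ • f.1 g), h3, add_comm]

/-- **The scalar case of Sah's identity**: if moreover `g₀` acts on `M` as the scalar `c ∈ ℤ`, then
`(c − 1) • f g = g • f g₀ − f g₀` — the crossed homomorphism `(c − 1) f` is the coboundary of `f g₀`.
[cite: Sah1968, Prop. 2.7 (b)] -/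
theorem sub_one_zsmul_apply_eq_of_vanishingOn {N : Subgroup G} [N.Normal]
    (f : cocyclesVanishingOn M N) {g₀ : G} (hcomm : ∀ g : G, ∃ n ∈ N, g₀ * g = g * g₀ * n)
    {c : ℤ} (hc : ∀ x : M, g₀ • x = c • x) (g : G) :
    (c - 1) • f.1 g = g • f.1 g₀ - f.1 g₀ := by
  rw [sub_smul, one_smul, ← hc]
  exact smul_sub_apply_eq_of_vanishingOn f hcomm g

/-- **Sah's identity, `1 − c` form**: `(1 − c) • f g = g • (−f g₀) − (−f g₀)` — the crossed
homomorphism `(1 − c) f` is the coboundary of `−f g₀`. [cite: Sah1968, Prop. 2.7 (b)] -/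
theorem one_sub_zsmul_apply_eq_of_vanishingOn {N : Subgroup G} [N.Normal]
    (f : cocyclesVanishingOn M N) {g₀ : G} (hcomm : ∀ g : G, ∃ n ∈ N, g₀ * g = g * g₀ * n)
    {c : ℤ} (hc : ∀ x : M, g₀ • x = c • x) (g : G) :
    (1 - c) • f.1 g = g • (-f.1 g₀) - (-f.1 g₀) := by
  rw [sub_smul, one_smul, ← hc, ← neg_sub, smul_sub_apply_eq_of_vanishingOn f hcomm g, neg_sub,
    smul_neg]
  abel

end SahModN

section Inflation

variable {G : Type u} [Group G] [TopologicalSpace G] [IsTopologicalGroup G]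
variable {M : Type u} [AddCommGroup M] [DistribMulAction G M] [TopologicalSpace M]
  [DiscreteTopology M]

/-- **`(c − 1)` kills the inflated classes.** For `N ⊴ G` open, `g₀` central modulo `N` acting on
`M` as the scalar `c`, and `f` a crossed homomorphism vanishing on `N`:
`(c − 1) • inflClass M N hN f = 0` in `H¹_cont(G, M)`. [cite: Sah1968, Prop. 2.7 (b)]
[cite: SerreGaloisCohomology1997, I.§5.8] -/
theorem sub_one_zsmul_inflClass_eq_zero {N : Subgroup G} [N.Normal] (hN : IsOpen (N : Set G))
    (f : cocyclesVanishingOn M N) {g₀ : G} (hcomm : ∀ g : G, ∃ n ∈ N, g₀ * g = g * g₀ * n)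
    {c : ℤ} (hc : ∀ x : M, g₀ • x = c • x) :
    (c - 1) • inflClass M N hN f = 0 := by
  rw [← map_zsmul, inflClass_apply, GaloisRepresentations.oneCocycleClass_eq_zero_iff]
  refine ⟨f.1 g₀, fun g ↦ ?_⟩
  rw [discreteTopRep_ρ_apply, toContOneCocycle_apply]
  change (c - 1) • f.1 g = g • f.1 g₀ - f.1 g₀
  exact sub_one_zsmul_apply_eq_of_vanishingOn f hcomm hc g

/-- **`(c − 1)` kills the kernel of restriction to `N`.** Under the same hypotheses, every
`κ ∈ ker (H¹_cont(G, M) → H¹_cont(N, M))` satisfies `(c − 1) • κ = 0` (the kernel is inflated,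
`resKer_le_range_inflClass`). For `c − 1` invertible on `M` this is the tree's vanishing
`subgroupResKer_eq_bot_of_bijOn`; the present form is what survives at `p = 2`.
[cite: Sah1968, Prop. 2.7 (b)] [cite: SerreGaloisCohomology1997, I.§5.8] -/
theorem sub_one_zsmul_eq_zero_of_mem_subgroupResKer (N : Subgroup G) [N.Normal]
    (hN : IsOpen (N : Set G)) {g₀ : G} (hcomm : ∀ g : G, ∃ n ∈ N, g₀ * g = g * g₀ * n)
    {c : ℤ} (hc : ∀ x : M, g₀ • x = c • x) {κ : discreteH1 G M} (hκ : κ ∈ subgroupResKer M N) :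
    (c - 1) • κ = 0 := by
  have hle := resKer_le_range_inflClass (subgroupIncl N) (AddMonoidHom.id M) (fun _ _ ↦ rfl)
    Function.bijective_id N hN (fun n hn ↦ ⟨⟨n, hn⟩, rfl⟩)
  obtain ⟨f, rfl⟩ := hle hκ
  exact sub_one_zsmul_inflClass_eq_zero hN f hcomm hc

/-- **`(1 − c)` kills the inflated classes** (the form convenient for `c = −1`: `1 − c = 2`).
[cite: Sah1968, Prop. 2.7 (b)] [cite: SerreGaloisCohomology1997, I.§5.8] -/
theorem one_sub_zsmul_inflClass_eq_zero {N : Subgroup G} [N.Normal] (hN : IsOpen (N : Set G))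
    (f : cocyclesVanishingOn M N) {g₀ : G} (hcomm : ∀ g : G, ∃ n ∈ N, g₀ * g = g * g₀ * n)
    {c : ℤ} (hc : ∀ x : M, g₀ • x = c • x) :
    (1 - c) • inflClass M N hN f = 0 := by
  rw [← map_zsmul, inflClass_apply, GaloisRepresentations.oneCocycleClass_eq_zero_iff]
  refine ⟨-f.1 g₀, fun g ↦ ?_⟩
  rw [discreteTopRep_ρ_apply, toContOneCocycle_apply]
  change (1 - c) • f.1 g = g • (-f.1 g₀) - (-f.1 g₀)
  exact one_sub_zsmul_apply_eq_of_vanishingOn f hcomm hc g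

/-- **`(1 − c)` kills the kernel of restriction to `N`** (companion of
`sub_one_zsmul_eq_zero_of_mem_subgroupResKer`). [cite: Sah1968, Prop. 2.7 (b)]
[cite: SerreGaloisCohomology1997, I.§5.8] -/
theorem one_sub_zsmul_eq_zero_of_mem_subgroupResKer (N : Subgroup G) [N.Normal]
    (hN : IsOpen (N : Set G)) {g₀ : G} (hcomm : ∀ g : G, ∃ n ∈ N, g₀ * g = g * g₀ * n)
    {c : ℤ} (hc : ∀ x : M, g₀ • x = c • x) {κ : discreteH1 G M} (hκ : κ ∈ subgroupResKer M N) :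
    (1 - c) • κ = 0 := by
  have hle := resKer_le_range_inflClass (subgroupIncl N) (AddMonoidHom.id M) (fun _ _ ↦ rfl)
    Function.bijective_id N hN (fun n hn ↦ ⟨⟨n, hn⟩, rfl⟩)
  obtain ⟨f, rfl⟩ := hle hκ
  exact one_sub_zsmul_inflClass_eq_zero hN f hcomm hc

omit [IsTopologicalGroup G] in
/-- **The kernel of restriction grows as the subgroup shrinks**: for `H' ≤ H`,
`ker (H¹(G, M) → H¹(H, M)) ⊆ ker (H¹(G, M) → H¹(H', M))` (a cocycle principal on `H` is principal
on `H'`). [cite: SerreGaloisCohomology1997, I.§5.8] -/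
theorem subgroupResKer_antitone [IsTopologicalGroup G] {H H' : Subgroup G} (h : H' ≤ H) :
    subgroupResKer M H ≤ subgroupResKer M H' := by
  intro κ hκ
  obtain ⟨φ, rfl⟩ := GaloisRepresentations.oneCocycleClass_surjective (discreteTopRep G M) κ
  obtain ⟨a, ha⟩ := (oneCocycleClass_mem_subgroupResKer_iff H φ).1 hκ
  exact (oneCocycleClass_mem_subgroupResKer_iff H' φ).2 ⟨a, fun σ ↦ ha ⟨σ, h σ.2⟩⟩

end Inflation

end Rubin1987

/-! ### §2 Elliptic curves: ONE homothety `a` on `E[n]` kills the kernel by `a − 1` -/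

namespace LawsonWuthrich2016

variable {K : Type u} [Field K] (W : WeierstrassCurve K)

/-- A homothety on `E[n]` is central modulo every `N ⊇ Γ_{K(E[n])}`: `σ g = g σ n` with
`n = σ⁻¹ g⁻¹ σ g` fixing `E[n]` pointwise. [folklore] -/
private theorem exists_mul_eq_mul_mul_of_homothety {n : ℤ} {σ : absoluteGaloisGroup K} {a : ℤ}
    (hσ : ∀ P : geomTorsion W n, σ • P = a • P) (N : Subgroup (absoluteGaloisGroup K))
    (hle : torsionFixing W n ≤ N) (g : absoluteGaloisGroup K) :
    ∃ m ∈ N, σ * g = g * σ * m := by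
  refine ⟨(g * σ)⁻¹ * (σ * g), hle ((mem_torsionFixing_iff W n).2 fun P ↦ ?_),
    by rw [mul_inv_cancel_left]⟩
  rw [mul_inv_rev, mul_smul, mul_smul, mul_smul, hσ, smul_comm g⁻¹ a, inv_smul_smul, ← hσ,
    inv_smul_smul]

/-- **`(a − 1) · H¹(Gal(L/K), E(L)[n]) = 0` from ONE homothety.** Let `E/K` be an elliptic curve over
any field (model `W`), `n ≠ 0`, and let ONE `σ ∈ Γ_K` act on `E[n]` as the homothety `a ∈ ℤ`. Then
for every open normal `N ⊴ Γ_K` containing `Γ_{K(E[n])}` — `N = Gal(K̄/L)` for a finite Galois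
`L ⊆ K(E[n])` — every class `κ ∈ ker (H¹(Γ_K, E[n]) → H¹(N, E[n])) = H¹(Gal(L/K), E(L)[n])`
satisfies `(a − 1) • κ = 0`. (For `p ∤ a − 1` on `E[p^j]` this gives the tree's vanishing
`subgroupResKer_geomTorsion_eq_bot_of_homothety`; at `p = 2` every homothety has `a − 1` even and
this annihilator is the statement that survives.) [cite: LawsonWuthrich2016, Lemma 3]
[cite: Sah1968, Prop. 2.7 (b)] -/
theorem sub_one_zsmul_eq_zero_of_mem_subgroupResKer_of_homothety {n : ℤ}
    {σ : absoluteGaloisGroup K} {a : ℤ} (hσ : ∀ P : geomTorsion W n, σ • P = a • P)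
    (N : Subgroup (absoluteGaloisGroup K)) [N.Normal] (hN : IsOpen (N : Set (absoluteGaloisGroup K)))
    (hle : torsionFixing W n ≤ N) {κ : discreteH1 (absoluteGaloisGroup K) (geomTorsion W n)}
    (hκ : κ ∈ subgroupResKer (geomTorsion W n) N) : (a - 1) • κ = 0 :=
  Rubin1987.sub_one_zsmul_eq_zero_of_mem_subgroupResKer N hN
    (exists_mul_eq_mul_mul_of_homothety W hσ N hle) hσ hκ

/-- **`2 · H¹(Gal(L/K), E(L)[n]) = 0` when `−1 ∈ ρ̄_{E,n}(Γ_K)`.** If some `σ ∈ Γ_K` acts as `−1`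
on `E[n]`, then `2 • κ = 0` for every `κ ∈ ker (H¹(Γ_K, E[n]) → H¹(N, E[n]))`, `N ⊴ Γ_K` open with
`Γ_{K(E[n])} ≤ N`. [cite: LawsonWuthrich2016, Lemma 3] [cite: Sah1968, Prop. 2.7 (b)] -/
theorem two_zsmul_eq_zero_of_mem_subgroupResKer_of_smul_eq_neg {n : ℤ}
    {σ : absoluteGaloisGroup K} (hσ : ∀ P : geomTorsion W n, σ • P = -P)
    (N : Subgroup (absoluteGaloisGroup K)) [N.Normal] (hN : IsOpen (N : Set (absoluteGaloisGroup K)))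
    (hle : torsionFixing W n ≤ N) {κ : discreteH1 (absoluteGaloisGroup K) (geomTorsion W n)}
    (hκ : κ ∈ subgroupResKer (geomTorsion W n) N) : (2 : ℤ) • κ = 0 := by
  have hσ' : ∀ P : geomTorsion W n, σ • P = (-1 : ℤ) • P := fun P ↦ by rw [hσ P, neg_one_zsmul]
  have h := Rubin1987.one_sub_zsmul_eq_zero_of_mem_subgroupResKer N hN
    (exists_mul_eq_mul_mul_of_homothety W hσ' N hle) hσ' hκ
  rwa [show (1 : ℤ) - (-1) = 2 by norm_num] at h

/-- A surjective mod-`n` representation contains the homothety `−1`: some `σ ∈ Γ_K` acts as `−P`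
on `E[n]` (Lawson–Wuthrich's standing reduction "`G` contains a non-trivial homothety", §2, for the
full image). [cite: LawsonWuthrich2016, §2 (before Lemma 3)] [cite: Serre1972, §4] -/
theorem exists_smul_eq_neg_of_hasSurjectiveModNGaloisRep {n : ℤ}
    (hsurj : W.HasSurjectiveModNGaloisRep n) :
    ∃ σ : absoluteGaloisGroup K, ∀ P : geomTorsion W n, σ • P = -P := by
  obtain ⟨σ, hσ⟩ := hsurj (Multiplicative.ofAdd (AddEquiv.neg (geomTorsion W n)))
  refine ⟨σ, fun P ↦ ?_⟩
  rw [← galoisRepTorsion_apply, hσ]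
  rfl

/-- **`2 · H¹(Gal(L/K), E(L)[n]) = 0` for SURJECTIVE `ρ̄_{E,n}`** (`n ≠ 0`; e.g. `n = 2^k` on the
habitat of the `p = 2` Kolyvagin routes): `2 • κ = 0` for every
`κ ∈ ker (H¹(Γ_K, E[n]) → H¹(N, E[n]))`, `N ⊴ Γ_K` open with `Γ_{K(E[n])} ≤ N`, in particular for
`N = Γ_{K(E[n])}` itself (`H¹(K(E[n])/K, E[n])` is killed by `2`). [cite: LawsonWuthrich2016, Lemma 3, §7.1]
[cite: Sah1968, Prop. 2.7 (b)] -/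
theorem two_zsmul_eq_zero_of_mem_subgroupResKer_of_hasSurjectiveModNGaloisRep {n : ℤ}
    (hsurj : W.HasSurjectiveModNGaloisRep n)
    (N : Subgroup (absoluteGaloisGroup K)) [N.Normal] (hN : IsOpen (N : Set (absoluteGaloisGroup K)))
    (hle : torsionFixing W n ≤ N) {κ : discreteH1 (absoluteGaloisGroup K) (geomTorsion W n)}
    (hκ : κ ∈ subgroupResKer (geomTorsion W n) N) : (2 : ℤ) • κ = 0 := by
  obtain ⟨σ, hσ⟩ := exists_smul_eq_neg_of_hasSurjectiveModNGaloisRep W hsurj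
  exact two_zsmul_eq_zero_of_mem_subgroupResKer_of_smul_eq_neg W hσ N hN hle hκ

/-- **Pairing currency** (`HeegnerPointsKolyvaginPairing`): if `x ∈ H¹(K, E[n])` has `[x, ρ] = 0`
for every `ρ ∈ Γ_{K(E[n])}` and some `σ ∈ Γ_K` acts on `E[n]` as the homothety `a`, then
`(a − 1) • x = 0`; so the injectivity `(∀ ρ ∈ Γ_{K(E[n])}, [x, ρ] = 0) → x = 0` of the `p`-odd
arguments (`Rubin1987.eq_zero_of_forall_h1Eval_eq_zero`) holds at `p = 2` up to the factor `a − 1`.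
[cite: LawsonWuthrich2016, Lemma 3] [cite: GrossLMS1991, §9 (pairing after Prop. 9.1)] -/
theorem sub_one_zsmul_eq_zero_of_forall_h1Eval_eq_zero_of_homothety [W.IsElliptic] {n : ℤ}
    (hn : n ≠ 0) {σ : absoluteGaloisGroup K} {a : ℤ} (hσ : ∀ P : geomTorsion W n, σ • P = a • P)
    {x : galH1Torsion W n} (hx : ∀ ρ ∈ torsionFixing W n, h1Eval W n x ρ = 0) :
    (a - 1) • x = 0 := by
  have hmem : oneCocycleClass _ (reprCocycle W n x) ∈
      subgroupResKer (geomTorsion W n) (torsionFixing W n) :=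
    (oneCocycleClass_mem_subgroupResKer_iff _ _).2 ⟨0, fun ρ ↦ by
      rw [smul_zero, sub_zero]
      exact hx ρ ρ.2⟩
  rw [oneCocycleClass_reprCocycle] at hmem
  exact sub_one_zsmul_eq_zero_of_mem_subgroupResKer_of_homothety W hσ (torsionFixing W n)
    (isOpen_torsionFixing W hn) le_rfl hmem

/-- **Pairing currency, surjective image**: for `n ≠ 0` and `ρ̄_{E,n}` surjective, a class
`x ∈ H¹(K, E[n])` with `[x, ρ] = 0` for all `ρ ∈ Γ_{K(E[n])}` satisfies `2x = 0`.
[cite: LawsonWuthrich2016, Lemma 3, §7.1] -/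
theorem two_zsmul_eq_zero_of_forall_h1Eval_eq_zero_of_hasSurjectiveModNGaloisRep [W.IsElliptic]
    {n : ℤ} (hn : n ≠ 0) (hsurj : W.HasSurjectiveModNGaloisRep n) {x : galH1Torsion W n}
    (hx : ∀ ρ ∈ torsionFixing W n, h1Eval W n x ρ = 0) : (2 : ℤ) • x = 0 := by
  obtain ⟨σ, hσ⟩ := exists_smul_eq_neg_of_hasSurjectiveModNGaloisRep W hsurj
  have hmem : oneCocycleClass _ (reprCocycle W n x) ∈
      subgroupResKer (geomTorsion W n) (torsionFixing W n) :=
    (oneCocycleClass_mem_subgroupResKer_iff _ _).2 ⟨0, fun ρ ↦ by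
      rw [smul_zero, sub_zero]
      exact hx ρ ρ.2⟩
  rw [oneCocycleClass_reprCocycle] at hmem
  exact two_zsmul_eq_zero_of_mem_subgroupResKer_of_smul_eq_neg W hσ (torsionFixing W n)
    (isOpen_torsionFixing W hn) le_rfl hmem

end LawsonWuthrich2016

end Literature.NumberTheory.EllipticCurves

end
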